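import Literature.MathematicalPhysics.QuantumFieldTheory.TorusChartSpinWaveIntegral
import HarnessLib

/-!
# Pinned unfolding: summing a cube integral over the integer fields vanishing at the origin

The measure-theoretic identity behind the passage from compact angles to real ("non-compact") fields in
the Villain / Fröhlich–Spencer unfolding of an abelian lattice model on a finite torus `Λ`, in the form
needed when the integer BOND field `n` of the lift is regrouped by gauge classes `n = d₀ m + a`: the gauge
part `m : Λ → ℤ` is determined up to a constant, so one sums over the integer fields PINNED at the origin,
`m 0 = 0`, and correspondingly the angles `θ ∈ [0,2π)^Λ` unfold to the real fields pinned at the origin,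
`pinnedSet Λ = {φ : Λ → ℝ | φ 0 ∈ [0, 2π)}` (all other coordinates free):

* `TorusChart.cubeAt m = ∏_x [2π m_x, 2π m_x + 2π)` — the translate of the half-open cube
  `cubeIco Λ = [0,2π)^Λ` (`TorusChartSpinWaveIntegral`) by the lattice vector `2π m`; the cubes partition
  `Λ → ℝ` (`mem_cubeAt_iff`, `pairwise_disjoint_cubeAt`), and those with `m 0 = 0` partition the pinned set
  (`iUnion_cubeAt_eq_pinnedSet`);
* `TorusChart.setIntegral_cubeAt : ∫_{cubeAt m} G = ∫_{[0,2π)^Λ} G (2π m + θ) dθ` (translation invariance);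
* **`TorusChart.hasSum_setIntegral_cubeIco_vadd`**: for `G` integrable on the pinned set,
  `HasSum (m ↦ ∫_{[0,2π)^Λ} G (2π m + θ) dθ) (∫_{pinnedSet Λ} G)` over `m : PinnedInt Λ = {m // m 0 = 0}`,
  with the `tsum` form `setIntegral_pinnedSet_eq_tsum`;
* `TorusChart.integrableOn_pinnedSet_of_summable` — the integrability criterion in the same coordinates
  (each translate integrable on the cube and the cube integrals of `‖G (2π m + ·)‖` summable).

Everything is proved; no named fact is introduced.  (Compare `PeriodicUnfolding.lean`, the unpinned
identity `∫_{ℝ^k} F = Σ_ℓ ∫_{[-π,π)^k} F(θ + 2πℓ)`.)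

## References

* J. Fröhlich, T. Spencer, Comm. Math. Phys. 81 (1981) 527–602, §3 (the Villain model as a gas of
  vortices in a massless Gaussian field). [folklore form]
-/

noncomputable section

namespace Literature.MathematicalPhysics.QuantumFieldTheory

open scoped BigOperators
open _root_.MeasureTheory Set Real

namespace TorusChart

/-! ## The cubes `2π m + [0,2π)^Λ` -/

section Cubes

variable {Λ : Type*}

/-- The translate `∏_x [2π m_x, 2π m_x + 2π)` of the half-open cube `[0,2π)^Λ` by the lattice vector `2π m`.
[folklore] -/
def cubeAt (m : Λ → ℤ) : Set (Λ → ℝ) := Set.pi univ fun x => Ico (2 * π * m x) (2 * π * m x + 2 * π)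

/-- The index of the cube containing a real field: `m_x = ⌊φ_x / 2π⌋`. [folklore] -/
def cubeIdx (φ : Λ → ℝ) : Λ → ℤ := fun x => ⌊φ x / (2 * π)⌋

/-- One coordinate: `t ∈ [2π m, 2π m + 2π)` iff `m = ⌊t / 2π⌋`. [folklore] -/
theorem mem_Ico_two_pi_iff_eq_floor (t : ℝ) (m : ℤ) :
    t ∈ Ico (2 * π * m) (2 * π * m + 2 * π) ↔ m = ⌊t / (2 * π)⌋ := by
  have h2π : 0 < 2 * π := by positivity
  rw [eq_comm, Int.floor_eq_iff, mem_Ico, le_div_iff₀ h2π, div_lt_iff₀ h2π]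
  constructor <;> intro h <;> constructor <;> nlinarith [h.1, h.2]

/-- Membership in a cube is membership coordinatewise: `φ ∈ cubeAt m ↔ m = cubeIdx φ`. [folklore] -/
theorem mem_cubeAt_iff (φ : Λ → ℝ) (m : Λ → ℤ) : φ ∈ cubeAt m ↔ m = cubeIdx φ := by
  simp only [cubeAt, mem_pi, mem_univ, forall_true_left, funext_iff, cubeIdx]
  exact forall_congr' fun x => mem_Ico_two_pi_iff_eq_floor (φ x) (m x)

/-- The cube of index `0` is the half-open cube `[0,2π)^Λ`. [folklore] -/
theorem cubeAt_zero : cubeAt (0 : Λ → ℤ) = cubeIco Λ := by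
  simp [cubeAt, cubeIco]

/-- The cubes are pairwise disjoint. [folklore] -/
theorem pairwise_disjoint_cubeAt : Pairwise (Function.onFun Disjoint (cubeAt : (Λ → ℤ) → Set (Λ → ℝ))) := by
  intro m m' hne
  refine Set.disjoint_left.2 fun φ hφ hφ' => hne ?_
  rw [mem_cubeAt_iff] at hφ hφ'
  rw [hφ, hφ']

/-- The cubes are measurable. [folklore] -/
theorem measurableSet_cubeAt [Countable Λ] (m : Λ → ℤ) : MeasurableSet (cubeAt m) :=
  MeasurableSet.univ_pi fun _ => measurableSet_Ico

/-- `cubeAt m` is the translate of `[0,2π)^Λ` by `2π m`: `(· + 2π m)⁻¹' (cubeAt m) = [0,2π)^Λ`. [folklore] -/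
theorem preimage_add_cubeAt (m : Λ → ℤ) :
    (fun θ : Λ → ℝ => θ + ((latticeOf m : twoPiLattice Λ) : Λ → ℝ)) ⁻¹' cubeAt m = cubeIco Λ := by
  ext θ
  simp only [mem_preimage, cubeAt, cubeIco, mem_pi, mem_univ, forall_true_left, Pi.add_apply, coe_latticeOf,
    zsmul_eq_mul, mem_Ico]
  refine forall_congr' fun x => ?_
  constructor <;> intro h <;> constructor <;> linarith [h.1, h.2]

/-- The lattice action is translation: `2π m +ᵥ θ = θ + 2π m`. [folklore] -/
theorem latticeOf_vadd_eq_add (m : Λ → ℤ) (θ : Λ → ℝ) :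
    ((latticeOf m : twoPiLattice Λ) +ᵥ θ) = θ + ((latticeOf m : twoPiLattice Λ) : Λ → ℝ) := by
  funext x; rw [vadd_apply, Pi.add_apply, add_comm]

variable {E : Type*} [NormedAddCommGroup E]

/-- **Translation invariance**: `∫_{cubeAt m} G = ∫_{[0,2π)^Λ} G (2π m + θ) dθ`. [folklore] -/
theorem setIntegral_cubeAt [Fintype Λ] [NormedSpace ℝ E] (G : (Λ → ℝ) → E) (m : Λ → ℤ) :
    ∫ φ in cubeAt m, G φ = ∫ θ in cubeIco Λ, G ((latticeOf m : twoPiLattice Λ) +ᵥ θ) := by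
  have h := (measurePreserving_add_right (volume : Measure (Λ → ℝ))
    ((latticeOf m : twoPiLattice Λ) : Λ → ℝ)).setIntegral_preimage_emb
    (measurableEmbedding_addRight _) G (cubeAt m)
  rw [preimage_add_cubeAt] at h
  rw [← h]
  exact setIntegral_congr_fun measurableSet_cubeIco fun θ _ => by rw [latticeOf_vadd_eq_add]

/-- Integrability on a cube is integrability of the translate on `[0,2π)^Λ`. [folklore] -/
theorem integrableOn_cubeAt_iff [Fintype Λ] (G : (Λ → ℝ) → E) (m : Λ → ℤ) :
    IntegrableOn G (cubeAt m) ↔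
      IntegrableOn (fun θ => G ((latticeOf m : twoPiLattice Λ) +ᵥ θ)) (cubeIco Λ) := by
  have h := (measurePreserving_add_right (volume : Measure (Λ → ℝ))
    ((latticeOf m : twoPiLattice Λ) : Λ → ℝ)).integrableOn_comp_preimage
    (measurableEmbedding_addRight _) (f := G) (s := cubeAt m)
  rw [preimage_add_cubeAt] at h
  rw [← h]
  exact integrableOn_congr_fun (fun θ _ => by rw [Function.comp_apply, latticeOf_vadd_eq_add])
    measurableSet_cubeIco

end Cubes

/-! ## The pinned set and its tiling by the cubes with `m 0 = 0` -/

section Pinned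

variable (Λ : Type*) [Zero Λ]

/-- The **pinned real fields**: `φ : Λ → ℝ` with `φ 0 ∈ [0, 2π)` (the zero mode confined to one period, all
other coordinates free). [folklore] -/
def pinnedSet : Set (Λ → ℝ) := {φ | φ 0 ∈ Ico 0 (2 * π)}

/-- The **pinned integer fields**: `m : Λ → ℤ` with `m 0 = 0` (a gauge for `ℤ^Λ` modulo constants). [folklore] -/
def PinnedInt : Type _ := {m : Λ → ℤ // m 0 = 0}

variable {Λ}

/-- Membership in the pinned set. [folklore] -/
theorem mem_pinnedSet_iff (φ : Λ → ℝ) : φ ∈ pinnedSet Λ ↔ φ 0 ∈ Ico 0 (2 * π) := Iff.rfl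

/-- The pinned integer fields of a finite torus are countable. [folklore] -/
instance countable_pinnedInt [Finite Λ] : Countable (PinnedInt Λ) :=
  show Countable {m : Λ → ℤ // m 0 = 0} from Subtype.countable

/-- The pinned set is measurable. [folklore] -/
theorem measurableSet_pinnedSet : MeasurableSet (pinnedSet Λ) :=
  measurableSet_Ico.preimage (measurable_pi_apply (0 : Λ))

/-- A field is pinned iff its cube index vanishes at the origin. [folklore] -/
theorem mem_pinnedSet_iff_cubeIdx (φ : Λ → ℝ) : φ ∈ pinnedSet Λ ↔ cubeIdx φ 0 = 0 := by
  rw [mem_pinnedSet_iff, eq_comm]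
  have h := mem_Ico_two_pi_iff_eq_floor (φ 0) 0
  simp only [Int.cast_zero, mul_zero, zero_add] at h
  exact h

/-- **The cubes `2π m + [0,2π)^Λ` with `m 0 = 0` tile the pinned set.** [folklore] -/
theorem iUnion_cubeAt_eq_pinnedSet : (⋃ m : PinnedInt Λ, cubeAt (m.1 : Λ → ℤ)) = pinnedSet Λ := by
  ext φ
  simp only [mem_iUnion]
  constructor
  · rintro ⟨m, hm⟩
    rw [mem_cubeAt_iff] at hm
    rw [mem_pinnedSet_iff_cubeIdx, ← hm]
    exact m.2
  · intro hφ
    exact ⟨⟨cubeIdx φ, (mem_pinnedSet_iff_cubeIdx φ).1 hφ⟩, (mem_cubeAt_iff φ _).2 rfl⟩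

/-- The pinned cubes are pairwise disjoint. [folklore] -/
theorem pairwise_disjoint_cubeAt_pinned :
    Pairwise (Function.onFun Disjoint fun m : PinnedInt Λ => cubeAt (m.1 : Λ → ℤ)) :=
  fun _ _ hne => pairwise_disjoint_cubeAt fun h => hne (Subtype.ext h)

variable {E : Type*} [NormedAddCommGroup E]

/-- **Pinned unfolding.** For `G` integrable on the pinned set,
`HasSum (m ↦ ∫_{[0,2π)^Λ} G (2π m + θ) dθ) (∫_{pinnedSet Λ} G)` over the integer fields `m` with `m 0 = 0`.
[folklore] -/
theorem hasSum_setIntegral_cubeIco_vadd [Fintype Λ] [NormedSpace ℝ E] (G : (Λ → ℝ) → E)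
    (hG : IntegrableOn G (pinnedSet Λ)) :
    HasSum (fun m : PinnedInt Λ => ∫ θ in cubeIco Λ, G ((latticeOf m.1 : twoPiLattice Λ) +ᵥ θ))
      (∫ φ in pinnedSet Λ, G φ) := by
  have h := hasSum_integral_iUnion (μ := (volume : Measure (Λ → ℝ))) (f := G)
    (fun m : PinnedInt Λ => measurableSet_cubeAt (m.1 : Λ → ℤ)) pairwise_disjoint_cubeAt_pinned
    (by rw [iUnion_cubeAt_eq_pinnedSet]; exact hG)
  rw [iUnion_cubeAt_eq_pinnedSet] at h
  convert h using 2 with m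
  exact (setIntegral_cubeAt G m.1).symm

/-- **Pinned unfolding** (`tsum` form): `∫_{pinnedSet Λ} G = Σ'_{m, m 0 = 0} ∫_{[0,2π)^Λ} G (2π m + θ) dθ`.
[folklore] -/
theorem setIntegral_pinnedSet_eq_tsum [Fintype Λ] [NormedSpace ℝ E] (G : (Λ → ℝ) → E)
    (hG : IntegrableOn G (pinnedSet Λ)) :
    ∫ φ in pinnedSet Λ, G φ =
      ∑' m : PinnedInt Λ, ∫ θ in cubeIco Λ, G ((latticeOf m.1 : twoPiLattice Λ) +ᵥ θ) :=
  (hasSum_setIntegral_cubeIco_vadd G hG).tsum_eq.symm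

/-- **Integrability on the pinned set from the cube pieces**: if every translate `G (2π m + ·)`, `m 0 = 0`,
is integrable on `[0,2π)^Λ` and the cube integrals of the norms are summable, then `G` is integrable on the
pinned set. [folklore] -/
theorem integrableOn_pinnedSet_of_summable [Fintype Λ] (G : (Λ → ℝ) → E)
    (hi : ∀ m : PinnedInt Λ, IntegrableOn (fun θ => G ((latticeOf m.1 : twoPiLattice Λ) +ᵥ θ)) (cubeIco Λ))
    (hs : Summable fun m : PinnedInt Λ => ∫ θ in cubeIco Λ, ‖G ((latticeOf m.1 : twoPiLattice Λ) +ᵥ θ)‖) :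
    IntegrableOn G (pinnedSet Λ) := by
  rw [← iUnion_cubeAt_eq_pinnedSet]
  refine integrableOn_iUnion_of_summable_integral_norm (fun m => (integrableOn_cubeAt_iff G m.1).2 (hi m)) ?_
  refine hs.congr fun m => ?_
  exact (setIntegral_cubeAt (fun φ => ‖G φ‖) m.1).symm

/-- Conversely, integrability on the pinned set gives integrability of every pinned translate on the cube and
summability of the norms of the cube integrals. [folklore] -/
theorem summable_norm_setIntegral_cubeIco_vadd [Fintype Λ] [NormedSpace ℝ E] (G : (Λ → ℝ) → E)
    (hG : IntegrableOn G (pinnedSet Λ)) :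
    Summable fun m : PinnedInt Λ => ‖∫ θ in cubeIco Λ, G ((latticeOf m.1 : twoPiLattice Λ) +ᵥ θ)‖ := by
  have hn : HasSum (fun m : PinnedInt Λ => ∫ φ in cubeAt (m.1 : Λ → ℤ), ‖G φ‖)
      (∫ φ in ⋃ m : PinnedInt Λ, cubeAt (m.1 : Λ → ℤ), ‖G φ‖) :=
    hasSum_integral_iUnion (fun m : PinnedInt Λ => measurableSet_cubeAt (m.1 : Λ → ℤ))
      pairwise_disjoint_cubeAt_pinned (by rw [iUnion_cubeAt_eq_pinnedSet]; exact hG.norm)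
  refine Summable.of_nonneg_of_le (fun m => norm_nonneg _) (fun m => ?_) hn.summable
  rw [← setIntegral_cubeAt]
  exact norm_integral_le_integral_norm _

end Pinned

end TorusChart

end Literature.MathematicalPhysics.QuantumFieldTheory

end
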